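import Summits.QuantumFields.BalabanUV.T4Continuum.Spine.NE1p.DressedSmallFieldGeometryFaces
import Summits.QuantumFields.BalabanUV.T4Continuum.Spine.NE1p.DressedSmallFieldInductionFaces

/-!
# T⁴ programme, spine estimate NE1′ (node O3b/H2) — WITNESS W24 «THE TORUS FACE FIRES»: the owner's `muPart_locE_le_torus` (node N0o,
# `DressedSmallFieldGeometry`, p221125) APPLIED BY NAME on the periodic carrier `tsys 4 N` itself (every `N`), with a live one-cube
# activity pencil; every remaining socket a named lemma on pv22's `tgeometry 4 N` constants; the bounded μ-part GENUINELY ≠ 0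

Cell `pub-balaban`, sub-cell `t4`, row NE1′ formalisation crew (`t4/formal/NE1p/LEAVES.md` row W24 ∕ DAG N29za; typer R-T95 (ii)), unit
`b2b-balaban-t4-ne1p-formalise-leaf-04` (gen 10; v1.1 = §4 APPENDED by gen 11, §1–§3 byte-identical).  ADDITIVE — imports S24 `Spine/NE1p/DressedSmallFieldGeometryFaces` (for `K₀_four`
BY NAME; it re-exports N0o) ONLY + (v1.1) S26 `Spine/NE1p/DressedSmallFieldInductionFaces` (§4's torus face BY NAME); two toy DATA `def`s (`X₀`, `act`) + theorems; 0 `def … : Prop`, 0 cite, 0 sorry.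

WHAT THIS FILE DOES.  After N0o, the small-field μ-part face of NE1′ read on Bałaban's periodic carrier (`tsys 4 N`: non-empty
torus-face-connected families of cubes of `(ℤ/N)⁴`, tree length `torusTreeLen`; geometry `tgeometry 4 N`: incompatibility `TTouch`, ν = 9,
κ₀ = 64·log 162, K₀ = K₀(64,8), c₁ = 64, all PROVED in pv22) displays ONLY (E1)∕(E2) per polymer, the (2.38)-SHAPE majorant `hL3` against
`torusTreeLen`, the two clauses and the source window.  §1 makes each of them a NAMED decided lemma on ONE datum living on the real carrier
(`X₀ N` = the one-cube domain `{0}`; pencil `act c s Z := if Z.1 = {0} then s·c else 0`, slope `c = A/μ₁`; envelope `A·𝟙[Z.1 = {0}]` —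
`hL3_torus` holds on `X₀` by pv22's `torusTreeLen_singleton` and is toy-true BY CHOICE elsewhere; clauses at `r₁ = b = 0`, `R := 2κ₀ + 2`
= `128·log 162 + 2` (`rate_closed`), and the POSITIVE dressed constant `A := (e·K₀(64,8)·9·64)⁻¹` of S24 §3, `hsmall_torus` with EQUALITY);
§2 `muPart_fires_torus` applies N0o `muPart_locE_le_torus N` ONCE BY NAME (conclusion literal; closed form `muPart_fires_torus'`:
`‖E_μ({0}) − E_0({0})‖ ≤ K₀(64,8)·μ₀/(μ₁ − μ₀)`, pencil factor visible, μ₀∕μ₁ symbolic); §2b fires N0o §1's other three faces at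
`G := tgeometry 4 N` on the same datum, once each BY NAME (`envelope_fires_torus`, `holo_fires_torus`, `attached_fires_torus` — strength
pencil `ϱ = 2`, `A₀ = 0`, `A₁ = A/2`); §3 GENUINE: a torus domain inside a one-cube
footprint IS that domain, so `coveringFamilies univ (·.1) {0} = {{X₀}}`, `E_w({0}) = log Z({X₀}; w)`, `exp E_w({0}) = 1 + w X₀` (the tree's
`exp_polymerLogZ`), whence **`muPart_live_torus`**: the quantity bounded in §2 is `≠ 0` for every `μ ≠ 0` in the window.
v1.1 §4 (APPEND-ONLY, gen 11): S26's torus FACE `DressedSmallFieldInductionFaces.attachedPart_locE_le_of_printClause_four_torus` (p223789) of the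
owner's ϱ-FREE PRINT-CLAUSE END N0m v1.1 `attachedPart_locE_le_of_printClause_four` (p223427) fired ONCE BY NAME on the same datum (typer R-T100 (v) ∕ R-T104
(iii): «W24 v1.1 fires S26's torus face BY NAME — one application, one currency»): `A₀ = A₁ = A₄ := (4·(e·K₀(64,8)·9·64))⁻¹` (factor-4 clause `h4_torus`
WITH EQUALITY at r₁ = 0, `hle` by `le_rfl`, `0 < A₁` met), the face's radius `max 2 (A₄/A₄) = 2` (`pencilRadius_four`), rate `R := 2·(64·log 162) + 2`
(`hrate_torus_num`), **`printClause_fires_torus`** (conclusion literal; closed form `printClause_fires_torus'`: `‖E_1({0}) − E_0({0})‖ ≤ K₀(64,8)`) and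
**`printClause_live_torus`** (GENUINE: that quantity is `≠ 0`, via §3 `locE_cube_live` at `μ = 1`); mutants
`HOME/t4/b2b-balaban-t4-ne1p-formalise-leaf-04/g11/W24v11_M{1,2}*.NOT-TO-FILE.lean` rc 1 (factor 4 ↦ 3 in `h4_torus`; pencil slope denominator 2 ↦ 1 at `hm`).
Planted mutants (NOT filed; `HOME/t4/b2b-balaban-t4-ne1p-formalise-leaf-04/g10/W24_M{1,2,3}*.NOT-TO-FILE.lean`, rc 1 each): dressed constant
doubled (`hsmall`), `R := κ₀ + 2` (`hrate`), window normalisation dropped in `act` (`hm`).  CONTEXT BY NAME, nothing restated: W23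
`DressedSmallFieldPencilWitness` (N0j on the TOY carriers `Unit`∕`Pol`), S24 §3 `torusClauses_nonvacuous` (the clause arithmetic, same
`A, R, r₁`), pv22 `deliverables_torus_four` (B13's closing chain on this carrier).  New here only: an NE1p END applied on `tsys`∕`TDom`.
HONEST FRAMING.  A SHAPE inhabited on the REAL torus CARRIER with a TOY activity; nothing of Bałaban's densities ∕ (2.14) data ∕ (B1) ∕ (B3)
instantiated; discharges no wall item — (B1) `hrep`, (B3) the (2.38)-majorant at the dressed constant (= GAPS G-ne9p2-5) and the window stay
DISPLAYED binders of the owner's face, and which `A, R, r₁` Bałaban's activities realise is (B3), not this file; no locus quoted; ABSOLUTE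
RULE honoured.  NE1′ NOT printed, NOT proved; spine PROVED 0∕9; count 9 unchanged.  Rung (B)+1 on ONE finite four-torus — NOT infinite
volume, NOT a mass gap, NOT OS on ℝ⁴, NOT Clay.  HONEST DEPENDENCY: continuum YM on T⁴ ⇐ BetaPertH ∧ nine spine estimates (0/9 proved);
BetaPertH ⇐ (D1) ∧ (D4) ∧ CAP+tail; G-an2-4 gates asym, D1 and NE2/3/4.
-/

noncomputable section

namespace Summit.QuantumFields.BalabanUV.T4Continuum.NE1p.DressedSmallFieldTorusWitness

open Metric Set Complex
open Literature.MathematicalPhysics.QuantumFieldTheory.Balaban1983to89.B12TreeDecay (K₀ K₀_pos kappa₀ kappa₀_nonneg)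
open Literature.MathematicalPhysics.QuantumFieldTheory.Balaban1983to89.B13FamilySum (coveringFamilies mem_coveringFamilies)
open Literature.MathematicalPhysics.QuantumFieldTheory.Balaban1983to89.B13Resummation (locE)
open Literature.MathematicalPhysics.QuantumFieldTheory.Balaban1983to89.TreeLengthTorus (TPt TDom IsTDom tsys torusTreeLen
  torusTreeLen_singleton)
open Literature.MathematicalPhysics.QuantumFieldTheory.Balaban1983to89.TreeLengthTorusGeometry (tgeometry TTouch ttouch_symm)
open Literature.Probability.LatticeModels (truncatedWeight polymerLogZ polymerLogZ_empty exp_polymerLogZ polymerPartitionFunction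
  polymerPartitionFunction_insert)
open Summit.QuantumFields.BalabanUV.T4Continuum.NE1p.DressedSmallFieldGeometry (muPart_locE_le_torus torus_consts norm_locE_le_geom
  differentiableOn_locE_geom attachedPart_locE_le_geom)
open Summit.QuantumFields.BalabanUV.T4Continuum.NE1p.DressedSmallFieldGeometryFaces (K₀_four)

variable (N : ℕ) [NeZero N]

/-! ## §1 THE DATUM ON THE PERIODIC CARRIER `tsys 4 N`: one cube, a linear activity pencil, the located constants -/

omit [NeZero N] in
/-- A single cube of the torus is a localization domain (non-empty; face-connected by reflexivity). [folklore] -/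
theorem isTDom_singleton (a : TPt 4 N) : IsTDom ({a} : Finset (TPt 4 N)) :=
  ⟨Finset.singleton_nonempty a, fun x hx y hy => by
    rw [Finset.mem_singleton] at hx hy; subst hx; subst hy; exact Relation.ReflTransGen.refl⟩

/-- THE ONE-CUBE DOMAIN `{0}` of the four-torus of `N⁴` cubes, a member of Bałaban's catalogue `tsys 4 N` (toy DATA). [folklore] -/
def X₀ : TDom 4 N := ⟨{0}, isTDom_singleton N 0⟩

/-- The footprint of `X₀` is the cube `0`. [folklore] -/
@[simp] theorem X₀_val : (X₀ N).1 = {0} := rfl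

/-- A torus domain whose footprint is `{0}` IS `X₀`. [folklore] -/
theorem eq_X₀_iff (Z : TDom 4 N) : Z.1 = {0} ↔ Z = X₀ N := ⟨fun h => Subtype.ext h, fun h => h ▸ rfl⟩

/-- THE ACTIVITY PENCIL (toy DATA): `H_s(Z) = s·c` on the one-cube domain, `0` on every other domain of the torus. [folklore] -/
def act (c : ℝ) (s : ℂ) (Z : TDom 4 N) : ℂ := if Z.1 = {0} then s * c else 0

/-- The pencil on `X₀`. [folklore] -/
@[simp] theorem act_X₀ (c : ℝ) (s : ℂ) : act N c s (X₀ N) = s * c := if_pos rfl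

/-- At the origin of the source the pencil is the zero activity. [folklore] -/
@[simp] theorem act_zero (c : ℝ) (Z : TDom 4 N) : act N c 0 Z = 0 := by
  unfold act; split_ifs <;> simp

/-- (E1) ON THE TORUS: every activity of the pencil is holomorphic in the source (linear or zero). [folklore] -/
theorem hhol_torus (c ρ : ℝ) (X : (tsys 4 N).Dom) :
    ∀ Z : (tsys 4 N).Dom, Z.1 ⊆ X.1 → DifferentiableOn ℂ (fun s => act N c s Z) (ball (0 : ℂ) ρ) := by
  intro Z _; unfold act; split_ifs
  exacts [(differentiable_id.mul_const (c : ℂ)).differentiableOn, differentiableOn_const _]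

/-- (E2) ON THE TORUS: on the ball of radius `ρ` the pencil of slope `A/ρ` is dominated by `A·𝟙[Z = X₀]`. [folklore] -/
theorem hm_torus {A ρ : ℝ} (hA : 0 ≤ A) (hρ : 0 < ρ) (X : (tsys 4 N).Dom) :
    ∀ s ∈ ball (0 : ℂ) ρ, ∀ Z : (tsys 4 N).Dom, Z.1 ⊆ X.1 →
      ‖act N (A / ρ) s Z‖ ≤ (fun Z : (tsys 4 N).Dom => if Z.1 = {0} then A else 0) Z := by
  intro s hs Z _; simp only [act]; split_ifs
  · rw [norm_mul, Complex.norm_real, Real.norm_eq_abs, abs_of_nonneg (div_nonneg hA hρ.le)]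
    calc ‖s‖ * (A / ρ) ≤ ρ * (A / ρ) := by gcongr; exact (mem_ball_zero_iff.1 hs).le
      _ = A := by field_simp
  · simp

/-- THE (2.38)-SHAPE AGAINST THE REAL TREE LENGTH `torusTreeLen`: on `X₀` by `torusTreeLen_singleton`, elsewhere the envelope is `0`. [folklore] -/
theorem hL3_torus {A : ℝ} (hA : 0 ≤ A) (R : ℝ) (X : (tsys 4 N).Dom) :
    ∀ Z : (tsys 4 N).Dom, Z.1 ⊆ X.1 →
      (fun Z : (tsys 4 N).Dom => if Z.1 = {0} then A else 0) Z ≤ A * Real.exp (-(R * (tsys 4 N).dj Z)) := by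
  intro Z _; simp only; split_ifs with h
  · have hd : (tsys 4 N).dj Z = 0 := by show torusTreeLen Z.1 = 0; rw [h]; exact torusTreeLen_singleton 0
    rw [hd, mul_zero, neg_zero, Real.exp_zero, mul_one]
  · positivity

/-- The located prefactor `e·K₀(64,8)·9·64` is positive. [folklore] -/
theorem prefactor_pos : 0 < Real.exp 1 * K₀ 64 8 * 9 * 64 := by have := K₀_pos (64 : ℝ) 8; positivity

/-- THE «ε SMALL» CLAUSE WITH EQUALITY at `r₁ = b = 0`, `A := (e·K₀(64,8)·9·64)⁻¹` (S24 §3's witness); constants by `K₀_four`∕`torus_consts`. [folklore] -/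
theorem hsmall_torus : (Real.exp 1 * K₀ 64 8 * 9 * 64)⁻¹ * Real.exp (0 + 1) * (tgeometry 4 N).K₀ * (tgeometry 4 N).ν *
    (tgeometry 4 N).c₁ ≤ 1 := by
  rw [zero_add, K₀_four, (torus_consts N).1, (torus_consts N).2.2]
  rw [show (Real.exp 1 * K₀ 64 8 * 9 * 64)⁻¹ * Real.exp 1 * K₀ 64 8 * 9 * 64 =
      (Real.exp 1 * K₀ 64 8 * 9 * 64)⁻¹ * (Real.exp 1 * K₀ 64 8 * 9 * 64) by ring, inv_mul_cancel₀ prefactor_pos.ne']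

/-- THE «κ LARGE» CLAUSE at `r₁ = 0` with the located rate `R := 2κ₀ + 2`. [folklore] -/
theorem hrate_torus : (0 : ℝ) + 2 * (tgeometry 4 N).κ₀ + 2 ≤ 2 * (tgeometry 4 N).κ₀ + 2 := by rw [zero_add]

/-- The located rate in print's letters: `2κ₀ + 2 = 128·log 162 + 2`. [folklore] -/
theorem rate_closed : 2 * (tgeometry 4 N).κ₀ + 2 = 128 * Real.log 162 + 2 := by rw [(torus_consts N).2.1]; ring

omit [NeZero N] in
/-- THE DRESSED CONSTANT IS AT MOST ONE: `(e·K₀(64,8)·9·64)⁻¹ ≤ 1`, since `K₀(64,8) = e^{κ₀}/81 ≥ 1/81` (κ₀ ≥ 0) and `e ≥ 1`. [folklore] -/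
theorem dressedConst_le_one : (Real.exp 1 * K₀ 64 8 * 9 * 64)⁻¹ ≤ 1 := by
  apply inv_le_one_of_one_le₀
  have he : 1 ≤ Real.exp 1 := Real.one_le_exp zero_le_one
  have hK : 1 / 81 ≤ K₀ (64 : ℝ) 8 := by
    unfold K₀
    rw [show (((8 : ℕ) : ℝ) + 1) ^ 2 = 81 by norm_num]
    exact div_le_div_of_nonneg_right (Real.one_le_exp (kappa₀_nonneg (by norm_num) _)) (by norm_num)
  have h := mul_le_mul he hK (by norm_num) (Real.exp_pos 1).le; rw [one_mul] at h
  calc (1 : ℝ) ≤ 1 / 81 * 9 * 64 := by norm_num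
    _ ≤ Real.exp 1 * K₀ 64 8 * 9 * 64 := by gcongr

/-! ## §2 THE TORUS FACE FIRES — N0o `muPart_locE_le_torus` applied ONCE BY NAME, every socket a lemma of §1 -/

open Classical in
/-- **W24 — THE μ-PART FACE OF NE1′ FIRES ON BAŁABAN'S PERIODIC CARRIER**: N0o `muPart_locE_le_torus` BY NAME, ONE application, conclusion
LITERAL at `r₁ = b = 0`, `R = 2κ₀ + 2`, `A = (e·K₀(64,8)·9·64)⁻¹`, envelope `A·𝟙[Z = X₀]`, activity `act (A/μ₁)`; μ₀, μ₁ symbolic. [folklore] -/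
theorem muPart_fires_torus {μ₁ μ₀ : ℝ} {μ : ℂ} (h0 : 0 < μ₀) (h01 : μ₀ < μ₁) (hμ : ‖μ‖ ≤ μ₀) :
    ‖locE (TTouch (d := 4) (N := N)) (fun Z : (tsys 4 N).Dom => Z.1) (act N ((Real.exp 1 * K₀ 64 8 * 9 * 64)⁻¹ / μ₁) μ) (X₀ N).1 -
        locE (TTouch (d := 4) (N := N)) (fun Z : (tsys 4 N).Dom => Z.1) (act N ((Real.exp 1 * K₀ 64 8 * 9 * 64)⁻¹ / μ₁) 0) (X₀ N).1‖ ≤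
      Real.exp 1 * (tgeometry 4 N).ν * (tgeometry 4 N).c₁ * (tgeometry 4 N).K₀ ^ 2 * (Real.exp 1 * K₀ 64 8 * 9 * 64)⁻¹ *
        Real.exp (-(0 * (tsys 4 N).dj (X₀ N))) * (μ₀ / (μ₁ - μ₀)) :=
  muPart_locE_le_torus N (m := fun Z : (tsys 4 N).Dom => if Z.1 = {0} then (Real.exp 1 * K₀ 64 8 * 9 * 64)⁻¹ else 0)
    (b := 0) (R := 2 * (tgeometry 4 N).κ₀ + 2)
    (inv_nonneg.2 prefactor_pos.le) le_rfl (by rw [zero_mul]) (hrate_torus N) (hsmall_torus N)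
    (hhol_torus N _ μ₁ (X₀ N)) (hm_torus N (inv_nonneg.2 prefactor_pos.le) (h0.trans h01) (X₀ N))
    (hL3_torus N (inv_nonneg.2 prefactor_pos.le) _ (X₀ N)) h0 h01 hμ

open Classical in
/-- CLOSED FORM: `‖E_μ({0}) − E_0({0})‖ ≤ K₀(64,8)·μ₀/(μ₁ − μ₀)` (envelope `e·ν·c₁·K₀²·A = K₀`, decay `e⁰ = 1`, pencil factor visible). [folklore] -/
theorem muPart_fires_torus' {μ₁ μ₀ : ℝ} {μ : ℂ} (h0 : 0 < μ₀) (h01 : μ₀ < μ₁) (hμ : ‖μ‖ ≤ μ₀) :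
    ‖locE (TTouch (d := 4) (N := N)) (fun Z : (tsys 4 N).Dom => Z.1) (act N ((Real.exp 1 * K₀ 64 8 * 9 * 64)⁻¹ / μ₁) μ) (X₀ N).1 -
        locE (TTouch (d := 4) (N := N)) (fun Z : (tsys 4 N).Dom => Z.1) (act N ((Real.exp 1 * K₀ 64 8 * 9 * 64)⁻¹ / μ₁) 0) (X₀ N).1‖ ≤
      K₀ 64 8 * (μ₀ / (μ₁ - μ₀)) := by
  have h := muPart_fires_torus N h0 h01 hμ
  rw [zero_mul, neg_zero, Real.exp_zero, mul_one, K₀_four, (torus_consts N).1, (torus_consts N).2.2] at h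
  refine h.trans (le_of_eq ?_)
  have hK : K₀ (64 : ℝ) 8 ≠ 0 := (K₀_pos _ _).ne'
  have he : Real.exp 1 ≠ 0 := (Real.exp_pos 1).ne'
  field_simp

/-! ## §2b THE OTHER THREE FACES OF N0o §1 AT `G := tgeometry 4 N` ON THE SAME DATUM (envelope, holomorphy, strength pencil) -/

open Classical in
/-- THE μ-UNIFORM (2.41) ENVELOPE FIRES ON THE TORUS (N0o `norm_locE_le_geom` at `G := tgeometry 4 N`, BY NAME, once): `‖E_s({0})‖ ≤
e·ν·c₁·K₀²·A·e⁰` for every source `‖s‖ < μ₁`. [folklore] -/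
theorem envelope_fires_torus {μ₁ : ℝ} (hμ₁ : 0 < μ₁) {s : ℂ} (hs : s ∈ ball (0 : ℂ) μ₁) :
    ‖locE (tgeometry 4 N).ι (tgeometry 4 N).cubes (act N ((Real.exp 1 * K₀ 64 8 * 9 * 64)⁻¹ / μ₁) s) ((tgeometry 4 N).cubes (X₀ N))‖ ≤
      Real.exp 1 * (tgeometry 4 N).ν * (tgeometry 4 N).c₁ * (tgeometry 4 N).K₀ ^ 2 * (Real.exp 1 * K₀ 64 8 * 9 * 64)⁻¹ *
        Real.exp (-(0 * (tsys 4 N).dj (X₀ N))) :=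
  norm_locE_le_geom (tsys 4 N) (tgeometry 4 N) (m := fun Z : (tsys 4 N).Dom => if Z.1 = {0} then (Real.exp 1 * K₀ 64 8 * 9 * 64)⁻¹ else 0)
    (b := 0) (R := 2 * (tgeometry 4 N).κ₀ + 2) (X₀ := X₀ N)
    (inv_nonneg.2 prefactor_pos.le) le_rfl (by rw [zero_mul]) (hrate_torus N) (hsmall_torus N)
    (hm_torus N (inv_nonneg.2 prefactor_pos.le) hμ₁ (X₀ N)) (hL3_torus N (inv_nonneg.2 prefactor_pos.le) _ (X₀ N)) hs

open Classical in
/-- HOLOMORPHY IN THE SOURCE FIRES ON THE TORUS (N0o `differentiableOn_locE_geom` at `G := tgeometry 4 N`, BY NAME, once): `s ↦ E_s({0})` is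
complex differentiable on the whole source ball. [folklore] -/
theorem holo_fires_torus {μ₁ : ℝ} (hμ₁ : 0 < μ₁) :
    DifferentiableOn ℂ (fun s => locE (tgeometry 4 N).ι (tgeometry 4 N).cubes (act N ((Real.exp 1 * K₀ 64 8 * 9 * 64)⁻¹ / μ₁) s)
      ((tgeometry 4 N).cubes (X₀ N))) (ball (0 : ℂ) μ₁) :=
  differentiableOn_locE_geom (tsys 4 N) (tgeometry 4 N) (m := fun Z : (tsys 4 N).Dom => if Z.1 = {0} then (Real.exp 1 * K₀ 64 8 * 9 * 64)⁻¹ else 0)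
    (b := 0) (R := 2 * (tgeometry 4 N).κ₀ + 2) (X₀ := X₀ N)
    (inv_nonneg.2 prefactor_pos.le) le_rfl (by rw [zero_mul]) (hrate_torus N) (hsmall_torus N) (hhol_torus N _ μ₁ (X₀ N))
    (hm_torus N (inv_nonneg.2 prefactor_pos.le) hμ₁ (X₀ N)) (hL3_torus N (inv_nonneg.2 prefactor_pos.le) _ (X₀ N))

open Classical in
/-- THE TABLE-STRENGTH (INDUCTION) FACE FIRES ON THE TORUS (N0o `attachedPart_locE_le_geom` at `G := tgeometry 4 N`, BY NAME, once, on THIS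
toy datum — not the general torus face): affine majorant with intercept `A₀ = 0`, slope `A₁ = A/2`, strength radius `ϱ = 2` (so `A₀ + ϱA₁ = A`
and the clause is again `hsmall_torus`); the attached part `E_1({0}) − E_0({0})` is `≤ 4·(e·ν·c₁·K₀²)·(A/2)·e⁰`. [folklore] -/
theorem attached_fires_torus :
    ‖locE (tgeometry 4 N).ι (tgeometry 4 N).cubes (act N ((Real.exp 1 * K₀ 64 8 * 9 * 64)⁻¹ / 2) 1) ((tgeometry 4 N).cubes (X₀ N)) -
        locE (tgeometry 4 N).ι (tgeometry 4 N).cubes (act N ((Real.exp 1 * K₀ 64 8 * 9 * 64)⁻¹ / 2) 0) ((tgeometry 4 N).cubes (X₀ N))‖ ≤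
      4 * (Real.exp 1 * (tgeometry 4 N).ν * (tgeometry 4 N).c₁ * (tgeometry 4 N).K₀ ^ 2) * ((Real.exp 1 * K₀ 64 8 * 9 * 64)⁻¹ / 2) *
        Real.exp (-(0 * (tsys 4 N).dj (X₀ N))) := by
  have hA := inv_nonneg.2 prefactor_pos.le
  have h2 : (0 : ℝ) + 2 * ((Real.exp 1 * K₀ 64 8 * 9 * 64)⁻¹ / 2) = (Real.exp 1 * K₀ 64 8 * 9 * 64)⁻¹ := by ring
  refine attachedPart_locE_le_geom (tsys 4 N) (tgeometry 4 N) (m := fun Z : (tsys 4 N).Dom => if Z.1 = {0} then (Real.exp 1 * K₀ 64 8 * 9 * 64)⁻¹ else 0)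
    (A₀ := 0) (b := 0) (R := 2 * (tgeometry 4 N).κ₀ + 2) (ϱ := 2) (X₀ := X₀ N)
    le_rfl (by positivity) le_rfl (by rw [zero_mul]) (hrate_torus N) (by rw [h2]; exact hsmall_torus N)
    (hhol_torus N _ 2 (X₀ N)) (hm_torus N hA two_pos (X₀ N)) (by rw [h2]; exact hL3_torus N hA _ (X₀ N)) le_rfl (by positivity)

/-! ## §3 GENUINE — the bounded quantity is NOT zero: `E_w({0}) = log Z({X₀}; w)` and `exp E_w({0}) = 1 + w X₀` -/

/-- The families of torus domains covering EXACTLY the cube `0` = `{{X₀}}` (a domain inside `{0}` is non-empty, so it IS `X₀`). [folklore] -/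
theorem coveringFamilies_cube :
    coveringFamilies (Finset.univ : Finset (TDom 4 N)) (fun Z : (tsys 4 N).Dom => Z.1) ({0} : Finset (TPt 4 N)) =
      ({{X₀ N}} : Finset (Finset (TDom 4 N))) := by
  ext C
  rw [mem_coveringFamilies, Finset.mem_singleton]
  constructor
  · rintro ⟨-, hC⟩
    have hZ : ∀ Z ∈ C, Z = X₀ N := fun Z hZ => by
      rw [← eq_X₀_iff]
      have hsub : Z.1 ⊆ {0} := hC ▸ Finset.subset_biUnion_of_mem (fun Z : (tsys 4 N).Dom => Z.1) hZ
      exact (Finset.Nonempty.subset_singleton_iff Z.2.1).1 hsub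
    have hne : C.Nonempty := by rw [Finset.nonempty_iff_ne_empty]; rintro rfl; simp at hC
    obtain ⟨Z, hZC⟩ := hne
    exact Finset.eq_singleton_iff_unique_mem.2 ⟨hZ Z hZC ▸ hZC, hZ⟩
  · rintro rfl
    exact ⟨Finset.subset_univ _, by simp⟩

open Classical in
/-- `E_w({0}) = log Z({X₀}; w)`: the truncated functional of the singleton family (`log Z(∅) = 0`). [folklore] -/
theorem locE_cube_eq (w : TDom 4 N → ℂ) :
    locE (TTouch (d := 4) (N := N)) (fun Z : (tsys 4 N).Dom => Z.1) w {0} = polymerLogZ (TTouch (d := 4) (N := N)) w {X₀ N} := by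
  unfold locE; rw [coveringFamilies_cube, Finset.sum_singleton]; unfold truncatedWeight
  have hp : ({X₀ N} : Finset (TDom 4 N)).powerset = {∅, {X₀ N}} := by
    rw [← Finset.insert_empty, Finset.powerset_insert, Finset.powerset_empty]; simp
  rw [hp, Finset.sum_insert (by simp), Finset.sum_singleton]; simp [polymerLogZ_empty]

open Classical in
/-- The one-polymer partition function along the ray: `Z({X₀}; t•w) = 1 + t·w X₀` (one-polymer recursion at `Λ = ∅`). [folklore] -/
theorem Z_cube_eq (w : TDom 4 N → ℂ) (t : ℂ) :
    polymerPartitionFunction (TTouch (d := 4) (N := N)) (fun Z => t * w Z) {X₀ N} = 1 + t * w (X₀ N) := by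
  rw [← Finset.insert_empty, polymerPartitionFunction_insert (fun _ _ h => ttouch_symm _ _ h) _ (Finset.notMem_empty _)]
  simp

open Classical in
/-- `exp E_w({0}) = 1 + w X₀` for `‖w X₀‖ < 1` (`exp_polymerLogZ`; the ray `1 + t·w X₀`, `t ∈ [0,1]`, never vanishes). [folklore] -/
theorem exp_locE_cube {w : TDom 4 N → ℂ} (hw : ‖w (X₀ N)‖ < 1) :
    Complex.exp (locE (TTouch (d := 4) (N := N)) (fun Z : (tsys 4 N).Dom => Z.1) w {0}) = 1 + w (X₀ N) := by
  rw [locE_cube_eq, exp_polymerLogZ]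
  · simpa using Z_cube_eq N w 1
  · intro t ht
    rw [Z_cube_eq]
    have h1 : ‖(t : ℂ) * w (X₀ N)‖ < 1 := by
      rw [norm_mul, Complex.norm_real, Real.norm_eq_abs, abs_of_nonneg ht.1]
      calc t * ‖w (X₀ N)‖ ≤ 1 * ‖w (X₀ N)‖ := by gcongr; exact ht.2
        _ < 1 := by rw [one_mul]; exact hw
    intro h0
    have : (t : ℂ) * w (X₀ N) = -1 := by linear_combination h0
    rw [this, norm_neg, norm_one] at h1
    exact lt_irrefl _ h1

open Classical in
/-- **GENUINE ON THE TORUS DATUM**: for `μ ≠ 0`, `0 < c`, `‖μ‖·c < 1`, `E_{act μ}({0}) ≠ E_{act 0}({0})` (exponentials `1 + μ·c ≠ 1`). [folklore] -/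
theorem locE_cube_live {c : ℝ} (hc : 0 < c) {μ : ℂ} (hμ : ‖μ‖ * c < 1) (hne : μ ≠ 0) :
    locE (TTouch (d := 4) (N := N)) (fun Z : (tsys 4 N).Dom => Z.1) (act N c μ) {0} ≠
      locE (TTouch (d := 4) (N := N)) (fun Z : (tsys 4 N).Dom => Z.1) (act N c 0) {0} := by
  intro heq
  have hn : ‖act N c μ (X₀ N)‖ < 1 := by
    rw [act_X₀, norm_mul, Complex.norm_real, Real.norm_eq_abs, abs_of_pos hc]; exact hμ
  have h0 : ‖act N c 0 (X₀ N)‖ < 1 := by rw [act_zero, norm_zero]; exact one_pos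
  have h1 := exp_locE_cube N hn
  rw [heq, exp_locE_cube N h0, act_zero, act_X₀] at h1
  have hz : μ * (c : ℂ) = 0 := by linear_combination -h1
  rcases mul_eq_zero.1 hz with h | h
  · exact hne h
  · exact hc.ne' (by exact_mod_cast h)

open Classical in
/-- **GENUINE AT ITS OWN LETTERS**: the quantity bounded by `muPart_fires_torus` is `≠ 0` for every `μ ≠ 0`, `‖μ‖ ≤ μ₀ < μ₁`. [folklore] -/
theorem muPart_live_torus {μ₁ μ₀ : ℝ} {μ : ℂ} (h0 : 0 < μ₀) (h01 : μ₀ < μ₁) (hμ : ‖μ‖ ≤ μ₀) (hne : μ ≠ 0) :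
    locE (TTouch (d := 4) (N := N)) (fun Z : (tsys 4 N).Dom => Z.1) (act N ((Real.exp 1 * K₀ 64 8 * 9 * 64)⁻¹ / μ₁) μ) (X₀ N).1 ≠
      locE (TTouch (d := 4) (N := N)) (fun Z : (tsys 4 N).Dom => Z.1) (act N ((Real.exp 1 * K₀ 64 8 * 9 * 64)⁻¹ / μ₁) 0) (X₀ N).1 := by
  have hμ₁ : 0 < μ₁ := h0.trans h01
  have hc : 0 < (Real.exp 1 * K₀ 64 8 * 9 * 64)⁻¹ / μ₁ := div_pos (inv_pos.2 prefactor_pos) hμ₁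
  refine locE_cube_live N hc ?_ hne
  calc ‖μ‖ * ((Real.exp 1 * K₀ 64 8 * 9 * 64)⁻¹ / μ₁) ≤ μ₀ * ((Real.exp 1 * K₀ 64 8 * 9 * 64)⁻¹ / μ₁) := by gcongr
    _ < μ₁ * ((Real.exp 1 * K₀ 64 8 * 9 * 64)⁻¹ / μ₁) := by gcongr
    _ = (Real.exp 1 * K₀ 64 8 * 9 * 64)⁻¹ := by field_simp
    _ ≤ 1 := dressedConst_le_one

open Summit.QuantumFields.BalabanUV.T4Continuum.NE1p.DressedSmallFieldInductionFaces (attachedPart_locE_le_of_printClause_four_torus)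

/-! ## §4 (v1.1) THE ϱ-FREE PRINT-CLAUSE END FIRES ON THE TORUS — S26 `attachedPart_locE_le_of_printClause_four_torus` (p223789; the torus FACE of the
owner's N0m v1.1 END `attachedPart_locE_le_of_printClause_four`, p223427) applied ONCE BY NAME on the SAME one-cube datum `X₀ N`: intercept = slope
`A₀ = A₁ = A₄ := (4·(e·K₀(64,8)·9·64))⁻¹` — so `hle : A₁ ≤ A₀` is `le_rfl`, `hA₁ : 0 < A₁` is met, and the factor-4 clause `h4 : 4·A₀·(e^{5r₁+1}·K₀(64,8)·9·64) ≤ 1`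
holds WITH EQUALITY at `r₁ = 0` (`h4_torus`); the face's own pencil radius `max 2 (A₀/A₁)` evaluates to `2` (`pencilRadius_four`), so (E1)∕(E2)∕(2.38)-shape are §1's
sockets at radius 2 with envelope `(A₄ + 2·A₄)·𝟙[Z = X₀]` and activity slope `(A₄ + 2·A₄)/2`; rate `R := 2·(64·log 162) + 2` (= §1's `rate_closed`).  Typer R-T100 (v) ∕
R-T104 (iii): «a torus face of the new END is NOT owed by S25 … W24 v1.1 fires S26's torus face BY NAME (one application, one currency)» — this §4 is that WITNESS;
the FACE is S26's.  HONEST: a decided toy activity on pv22's CONSTRUCTED carrier; `hL3` toy-true BY CHOICE ((B3) = G-ne9p2-5 UNPRINTED untouched); nothing of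
Bałaban's densities; no wall item. -/

/-- The located «factor-4» prefactor `4·(e·K₀(64,8)·9·64)` is positive. [folklore] -/
theorem prefactor4_pos : 0 < 4 * (Real.exp 1 * K₀ 64 8 * 9 * 64) := mul_pos four_pos prefactor_pos

/-- THE FACTOR-4 CLAUSE `h4` OF THE ϱ-FREE END WITH EQUALITY at `r₁ = 0`, `A₀ := A₄ = (4·(e·K₀(64,8)·9·64))⁻¹`, in S26's located numerals. [folklore] -/
theorem h4_torus : 4 * (4 * (Real.exp 1 * K₀ 64 8 * 9 * 64))⁻¹ * (Real.exp (5 * 0 + 1) * K₀ 64 8 * 9 * 64) ≤ 1 := by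
  rw [mul_zero, zero_add]
  rw [show 4 * (4 * (Real.exp 1 * K₀ 64 8 * 9 * 64))⁻¹ * (Real.exp 1 * K₀ 64 8 * 9 * 64) =
      (4 * (Real.exp 1 * K₀ 64 8 * 9 * 64))⁻¹ * (4 * (Real.exp 1 * K₀ 64 8 * 9 * 64)) by ring, inv_mul_cancel₀ prefactor4_pos.ne']

omit [NeZero N] in
/-- THE FACE'S OWN PENCIL RADIUS at equal intercept and slope: `max 2 (A₄/A₄) = 2`. [folklore] -/
theorem pencilRadius_four :
    max 2 ((4 * (Real.exp 1 * K₀ 64 8 * 9 * 64))⁻¹ / (4 * (Real.exp 1 * K₀ 64 8 * 9 * 64))⁻¹) = (2 : ℝ) := by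
  rw [div_self (inv_pos.2 prefactor4_pos).ne', max_eq_left (by norm_num : (1 : ℝ) ≤ 2)]

/-- THE «κ LARGE» CLAUSE at `r₁ = 0` in S26's located numerals, `R := 2·(64·log 162) + 2` (= §1 `rate_closed`'s number). [folklore] -/
theorem hrate_torus_num : (0 : ℝ) + 2 * (64 * Real.log 162) + 2 ≤ 2 * (64 * Real.log 162) + 2 := by rw [zero_add]

open Classical in
/-- **W24 §4 — THE ϱ-FREE PRINT-CLAUSE END OF NE1′'s SMALL-FIELD INDUCTION FIRES ON BAŁABAN'S PERIODIC CARRIER**: S26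
`DressedSmallFieldInductionFaces.attachedPart_locE_le_of_printClause_four_torus` BY NAME, ONE application, conclusion LITERAL at `A₀ = A₁ = A₄`, `r₁ = 0`,
`R = 2·(64·log 162) + 2`; sockets = §1's `hhol_torus` ∕ `hm_torus` ∕ `hL3_torus` at the face's radius `max 2 (A₄/A₄)` (= 2 by `pencilRadius_four`),
`hrate_torus_num`, `h4_torus`.  The attached part `E_1({0}) − E_0({0})` of the table-strength pencil is `≤ 4·(e·9·64·K₀(64,8)²)·A₄·e⁰`. [folklore] -/
theorem printClause_fires_torus :
    ‖locE (TTouch (d := 4) (N := N)) (fun Z : (tsys 4 N).Dom => Z.1)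
          (act N (((4 * (Real.exp 1 * K₀ 64 8 * 9 * 64))⁻¹ + 2 * (4 * (Real.exp 1 * K₀ 64 8 * 9 * 64))⁻¹) / 2) 1) (X₀ N).1 -
        locE (TTouch (d := 4) (N := N)) (fun Z : (tsys 4 N).Dom => Z.1)
          (act N (((4 * (Real.exp 1 * K₀ 64 8 * 9 * 64))⁻¹ + 2 * (4 * (Real.exp 1 * K₀ 64 8 * 9 * 64))⁻¹) / 2) 0) (X₀ N).1‖ ≤
      4 * (Real.exp 1 * 9 * 64 * K₀ 64 8 ^ 2) * (4 * (Real.exp 1 * K₀ 64 8 * 9 * 64))⁻¹ * Real.exp (-(0 * torusTreeLen (X₀ N).1)) := by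
  have hA : (0 : ℝ) ≤ (4 * (Real.exp 1 * K₀ 64 8 * 9 * 64))⁻¹ := inv_nonneg.2 prefactor4_pos.le
  have hA3 : (0 : ℝ) ≤ (4 * (Real.exp 1 * K₀ 64 8 * 9 * 64))⁻¹ + 2 * (4 * (Real.exp 1 * K₀ 64 8 * 9 * 64))⁻¹ := by positivity
  refine attachedPart_locE_le_of_printClause_four_torus (X₀ N)
    (m := fun Z : (tsys 4 N).Dom =>
      if Z.1 = {0} then (4 * (Real.exp 1 * K₀ 64 8 * 9 * 64))⁻¹ + 2 * (4 * (Real.exp 1 * K₀ 64 8 * 9 * 64))⁻¹ else 0)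
    (R := 2 * (64 * Real.log 162) + 2)
    hA (inv_pos.2 prefactor4_pos) le_rfl le_rfl hrate_torus_num h4_torus (hhol_torus N _ _ (X₀ N)) ?_ ?_
  · rw [pencilRadius_four]; exact hm_torus N hA3 two_pos (X₀ N)
  · rw [pencilRadius_four]; exact hL3_torus N hA3 _ (X₀ N)

open Classical in
/-- CLOSED FORM: the ϱ-free END's bound on the torus datum is `‖E_1({0}) − E_0({0})‖ ≤ K₀(64,8)` (`4·e·9·64·K₀²·A₄ = K₀` at `A₄ = (4·e·K₀·9·64)⁻¹`,
decay `e⁰ = 1`). [folklore] -/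
theorem printClause_fires_torus' :
    ‖locE (TTouch (d := 4) (N := N)) (fun Z : (tsys 4 N).Dom => Z.1)
          (act N (((4 * (Real.exp 1 * K₀ 64 8 * 9 * 64))⁻¹ + 2 * (4 * (Real.exp 1 * K₀ 64 8 * 9 * 64))⁻¹) / 2) 1) (X₀ N).1 -
        locE (TTouch (d := 4) (N := N)) (fun Z : (tsys 4 N).Dom => Z.1)
          (act N (((4 * (Real.exp 1 * K₀ 64 8 * 9 * 64))⁻¹ + 2 * (4 * (Real.exp 1 * K₀ 64 8 * 9 * 64))⁻¹) / 2) 0) (X₀ N).1‖ ≤ K₀ 64 8 := by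
  have h := printClause_fires_torus N
  rw [zero_mul, neg_zero, Real.exp_zero, mul_one] at h
  refine h.trans (le_of_eq ?_)
  have hK : K₀ (64 : ℝ) 8 ≠ 0 := (K₀_pos _ _).ne'
  have he : Real.exp 1 ≠ 0 := (Real.exp_pos 1).ne'
  field_simp

open Classical in
/-- **GENUINE AT ITS OWN LETTERS**: the quantity bounded by `printClause_fires_torus` is `≠ 0` — the attached table is LIVE on the torus datum
(`E_1({0}) ≠ E_0({0})`: exponentials `1 + 3A₄/2 ≠ 1`, by §3 `locE_cube_live` at `μ = 1`). [folklore] -/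
theorem printClause_live_torus :
    locE (TTouch (d := 4) (N := N)) (fun Z : (tsys 4 N).Dom => Z.1)
          (act N (((4 * (Real.exp 1 * K₀ 64 8 * 9 * 64))⁻¹ + 2 * (4 * (Real.exp 1 * K₀ 64 8 * 9 * 64))⁻¹) / 2) 1) (X₀ N).1 ≠
      locE (TTouch (d := 4) (N := N)) (fun Z : (tsys 4 N).Dom => Z.1)
          (act N (((4 * (Real.exp 1 * K₀ 64 8 * 9 * 64))⁻¹ + 2 * (4 * (Real.exp 1 * K₀ 64 8 * 9 * 64))⁻¹) / 2) 0) (X₀ N).1 := by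
  have hc : (0 : ℝ) < ((4 * (Real.exp 1 * K₀ 64 8 * 9 * 64))⁻¹ + 2 * (4 * (Real.exp 1 * K₀ 64 8 * 9 * 64))⁻¹) / 2 := by
    have := inv_pos.2 prefactor4_pos; positivity
  refine locE_cube_live N hc (μ := 1) ?_ one_ne_zero
  rw [norm_one, one_mul]
  have h1 : (4 * (Real.exp 1 * K₀ 64 8 * 9 * 64))⁻¹ ≤ 1 / 4 := by
    rw [mul_inv, show (1 : ℝ) / 4 = 4⁻¹ * 1 by norm_num]
    exact mul_le_mul_of_nonneg_left dressedConst_le_one (by norm_num)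
  linarith

end Summit.QuantumFields.BalabanUV.T4Continuum.NE1p.DressedSmallFieldTorusWitness

end
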